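import Literature.NumberTheory.Rogawski1990.GlobalAPacketLetters                 -- ★ p812883 (F0-typ3 (g4)): S2♭ `cohDiscrete_memXiFamily`, R♭ `memXiFamily_cohTokens_sameType` over ★ D6
import Literature.NumberTheory.Rogawski1990.CohomologicalSpectrumInnerForm       -- ★ E1 `innerFormMultiplicityLeOne`
import Summits.HodgeConjecture.HodgeConjecture.Theorems.F0P3MemXiFamilyTransfer  -- ★ p812633 (F0P3-p03 (g5)): `exists_muOmega` (Rogawski's auxiliary `μ`, §4.8)
import HarnessLib

/-!
# Crux `H413` — rung 4 glue: the three ENGINE LETTERS E1, S2♭, R♭ BY NAME from the sharpened engine deliverable shape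
# `innerFormCohClassification` (PLAN.F0P3g3 §19b: conjuncts (C1), (C2), (C3)), and (C3) ⟺ R♭

F0∕P3 «U3-mult», cell `hodgecm-mathlib`, crux H413 (`stmt-HodgeConjecture-24833`); line of record
`Cruxes/H413/Lines/F0_U3LettersRung1.lean` ED. 3 (open stubs `stub_E1 : Rogawski1990.innerFormMultiplicityLeOne`,
`stub_S2 : Rogawski1990.cohDiscrete_memXiFamily`, `stub_R : Rogawski1990.memXiFamily_cohTokens_sameType`).  F0P3-plan (g3) GO
06:56:25Z ∕ ruling (U2) 06:59:19Z (REF1 (g4) refinement: conclude the ★ CONSTANTS OUTRIGHT from FRAME-UNIFORM hypotheses).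

The engine lines (T1 `Lines/F0_T1InnerFormTraceIdentity.lean` ∘ packets) are to conclude, at the letters' frame
`(L) (ι H T hT) hdef h2 (μ) (μω hμu) hμω` of ★ `GlobalAPacketLetters`, the conjunction of
* (C1) `∀ P, multiplicity P.space.toContRep ≤ 1` — E1's body [Rogawski1990, Prop. 14.6.2, Thm. 14.6.4, Thm. 14.6.5];
* (C2) `∀ P, (coh-token of type δ ∈ {±1} on P.archModuleCM ι T hT) → ∃ ξ, MemXiFamily P … μω hμu ξ` — S2♭'s body [Thm. 14.6.4 + 15.2.1 (b) + 13.3.6 (c)];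
* (C3) `∃ sgn : OneDimAutRepH L → ℤ, ∀ P ξ, MemXiFamily P … μω hμu ξ → ∀ coh-token of type δ ∈ {±1}, δ = sgn ξ` [§12.3 p. 178 (the sign of
  `πⁿ(ξ_∞) ∈ {J⁺, J⁻}` by `ξ_∞`) + Thm. 14.6.4].
THIS FILE (0 `def`, 0 `sorry`, 0 named fact; pure logic over the ★ constants):
* §1 `innerFormMultiplicityLeOne_of_shape` — E1 BY NAME from (C1) stated at the letters' frame (the extra binders `μω hμu hμω` are
  discharged by ★ `F0P3MemXiFamilyTransfer.exists_muOmega`);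
* §2 `cohDiscrete_memXiFamily_of_shape` — S2♭ BY NAME from (C2) (the hypothesis IS the constant's body: zero paste drift by `defeq`);
* §3 `memXiFamily_cohTokens_sameType_of_shape` — R♭ BY NAME from (C3) (both tokens read `sgn ξ` for R♭'s single `ξ`; NO family rigidity U♭);
* §4 `letters_of_shape` — all three from the conjunction `∀ frame, (C1) ∧ (C2) ∧ (C3)` (the engine head shape, ONE statement);
* §5 `shape_C3_of_memXiFamily_cohTokens_sameType` and `shape_C3_iff` — (C3) is EQUIVALENT to R♭ as typed (`sgn ξ := 1` iff some member
  of the ξ-family carries a type-`1` token, else `−1`): the sharpened conjunct carries exactly R♭'s content, no more.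
The deliverable text (C3) the engine typists copy is the hypothesis `hC3` of §3, verbatim.
HONEST LABEL: HC_CM is proved only modulo the printed citations until rung 0 closes.

References: [Rogawski1990] §12.3 p. 178 (Prop. 12.3.3 and the definition of `πⁿ(ξ)` before it); §14.6 pp. 241–248 (Prop. 14.6.2,
Thm. 14.6.4, Thm. 14.6.5); Thm. 13.3.6 (c); Prop. 15.2.1; §15.3 ¶1; §4.8 p. 51.  [BorelWallach2000] II §5, VI Thm. 4.11.
-/

-- Mathlib idiom (as in ★ `GlobalAPacketLetters`): the commutator bracket on `Module.End ℂ M`, needed to MENTION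
-- `(uFormGroup (Fin 2) (Fin 1)).lie →ₗ⁅ℝ⁆ Module.End ℂ M` in the token shapes.
attribute [local instance 100] LieRing.ofAssociativeRing

set_option autoImplicit false
set_option linter.dupNamespace false

noncomputable section

open NumberField IsDedekindDomain MeasureTheory
open scoped Matrix ComplexOrder

namespace Summit.HodgeConjecture.HodgeConjecture.Cruxes.H413.F0P3LettersOfClassificationShape

open Literature.NumberTheory.Rogawski1990 Literature.NumberTheory.GaloisRepresentations
open Literature.NumberTheory.Automorphic Literature.NumberTheory.Automorphic.UnitaryGroup
open Literature.NumberTheory.Automorphic.UnitaryGroup.CotangentForms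
open Literature.RepresentationTheory.BorelWallach2000
open Literature.RepresentationTheory.KonnoKonno2007

/-! ## §1 E1 from (C1) at the letters' frame -/

/-- **E1 BY NAME from conjunct (C1) of the engine deliverable, stated at the letters' frame** (with Rogawski's auxiliary `μω`
among the binders, as the engine head carries it; the binders are discharged by ★ `exists_muOmega`: a unitary Hecke character of
`L` extending `ω_{L/L⁺}` exists).  The conclusion is the ★ constant `Rogawski1990.innerFormMultiplicityLeOne` outright, so the rung-4
fold is `stub_E1 := innerFormMultiplicityLeOne_of_shape engine_C1`.
[cite: Rogawski1990, §14.6 Prop. 14.6.2, Thm. 14.6.4, Thm. 14.6.5; Thm. 13.3.5; §4.8 p. 51] -/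
theorem innerFormMultiplicityLeOne_of_shape
    (hC1 : ∀ (L : Type) [Field L] [NumberField L] [IsCMField L] (ι : L →+* ℂ) (H : Matrix (Fin 3) (Fin 3) L) (T : GL (Fin 3) ℂ)
      (hT : (T : Matrix (Fin 3) (Fin 3) ℂ)ᴴ * H.map ι * (T : Matrix (Fin 3) (Fin 3) ℂ) = Literature.Geometry.ComplexHyperbolic.BallModel.J),
      (∀ τ' : L →+* ℂ, InfinitePlace.mk τ' ≠ InfinitePlace.mk ι → (H.map τ').PosDef) →
      2 ≤ Module.finrank ℚ ↥(maximalRealSubfield L) →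
      ∀ (μ : Measure (adelicGroupData (↥(maximalRealSubfield L)) L (IsCMField.complexConj L) 3 H).automorphicQuotient)
        [(adelicGroupData (↥(maximalRealSubfield L)) L (IsCMField.complexConj L) 3 H).IsAutomorphicMeasure μ]
        (μω : HeckeCharacter L) (hμu : μω.IsUnitary),
        (∀ x : Literature.NumberTheory.GaloisRepresentations.ideleGroup ↥(maximalRealSubfield L),
          μω (AdeleRing.ideleBaseChange (↥(maximalRealSubfield L)) L x) = quadraticHeckeCharCM L x) →
      ∀ (P : DiscreteAutomorphicRep (adelicGroupData (↥(maximalRealSubfield L)) L (IsCMField.complexConj L) 3 H) μ),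
        ((adelicGroupData (↥(maximalRealSubfield L)) L (IsCMField.complexConj L) 3 H).rightRegular μ).multiplicity
            P.space.toContRep ≤ 1) :
    innerFormMultiplicityLeOne := by
  intro L _ _ _ ι H T hT hdef h2 μ _ P
  obtain ⟨μω, hμu, hμω⟩ := F0P3MemXiFamilyTransfer.exists_muOmega L
  exact hC1 L ι H T hT hdef h2 μ μω hμu hμω P

/-- E1 from (C1) in E1's OWN frame (no `μω`): the hypothesis is the body of ★ `innerFormMultiplicityLeOne` token for token, so the
fold is definitional (recorded for the by-name consumer check). [cite: Rogawski1990, §14.6 Thm. 14.6.4] -/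
theorem innerFormMultiplicityLeOne_of_shape₀
    (hC1 : ∀ (L : Type) [Field L] [NumberField L] [IsCMField L] (ι : L →+* ℂ) (H : Matrix (Fin 3) (Fin 3) L) (T : GL (Fin 3) ℂ),
      (T : Matrix (Fin 3) (Fin 3) ℂ)ᴴ * H.map ι * (T : Matrix (Fin 3) (Fin 3) ℂ) = Literature.Geometry.ComplexHyperbolic.BallModel.J →
      (∀ τ' : L →+* ℂ, InfinitePlace.mk τ' ≠ InfinitePlace.mk ι → (H.map τ').PosDef) →
      2 ≤ Module.finrank ℚ ↥(maximalRealSubfield L) →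
      ∀ (μ : Measure (adelicGroupData (↥(maximalRealSubfield L)) L (IsCMField.complexConj L) 3 H).automorphicQuotient)
        [(adelicGroupData (↥(maximalRealSubfield L)) L (IsCMField.complexConj L) 3 H).IsAutomorphicMeasure μ]
        (P : DiscreteAutomorphicRep (adelicGroupData (↥(maximalRealSubfield L)) L (IsCMField.complexConj L) 3 H) μ),
        ((adelicGroupData (↥(maximalRealSubfield L)) L (IsCMField.complexConj L) 3 H).rightRegular μ).multiplicity
            P.space.toContRep ≤ 1) :
    innerFormMultiplicityLeOne :=
  hC1

/-! ## §2 S2♭ from (C2) -/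

/-- **S2♭ BY NAME from conjunct (C2)**: the hypothesis is the body of ★ `Rogawski1990.cohDiscrete_memXiFamily` token for token (an
`H¹`-cohomological discrete `P` — a non-zero `(𝔤, K)`-equivariant map from `P.archModuleCM ι T hT` to an irreducible module with a
degree-one class of type `δ ∈ {±1}` — lies in the ξ-local family of some one-dimensional automorphic `ξ`), so the rung-4 fold
`stub_S2 := cohDiscrete_memXiFamily_of_shape engine_C2` has zero paste drift.
[cite: Rogawski1990, §14.6 Thm. 14.6.4; Thm. 13.3.6 (c); Prop. 15.2.1 (b); §15.3 ¶1] -/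
theorem cohDiscrete_memXiFamily_of_shape
    (hC2 : ∀ (L : Type) [Field L] [NumberField L] [IsCMField L] (ι : L →+* ℂ) (H : Matrix (Fin 3) (Fin 3) L) (T : GL (Fin 3) ℂ)
      (hT : (T : Matrix (Fin 3) (Fin 3) ℂ)ᴴ * H.map ι * (T : Matrix (Fin 3) (Fin 3) ℂ) = Literature.Geometry.ComplexHyperbolic.BallModel.J),
      (∀ τ' : L →+* ℂ, InfinitePlace.mk τ' ≠ InfinitePlace.mk ι → (H.map τ').PosDef) →
      2 ≤ Module.finrank ℚ ↥(maximalRealSubfield L) →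
      ∀ (μ : Measure (adelicGroupData (↥(maximalRealSubfield L)) L (IsCMField.complexConj L) 3 H).automorphicQuotient)
        [(adelicGroupData (↥(maximalRealSubfield L)) L (IsCMField.complexConj L) 3 H).IsAutomorphicMeasure μ]
        (μω : HeckeCharacter L) (hμu : μω.IsUnitary),
        (∀ x : Literature.NumberTheory.GaloisRepresentations.ideleGroup ↥(maximalRealSubfield L),
          μω (AdeleRing.ideleBaseChange (↥(maximalRealSubfield L)) L x) = quadraticHeckeCharCM L x) →
      ∀ (P : DiscreteAutomorphicRep (adelicGroupData (↥(maximalRealSubfield L)) L (IsCMField.complexConj L) 3 H) μ)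
        (M : Type) [AddCommGroup M] [Module ℂ M] (σK : Representation ℂ (uFormGroup (Fin 2) (Fin 1)).maximalCompact M)
        (σ𝔤 : (uFormGroup (Fin 2) (Fin 1)).lie →ₗ⁅ℝ⁆ Module.End ℂ M) (hM : IsGKModule (uFormGroup (Fin 2) (Fin 1)) σK σ𝔤),
        IsIrreducibleGK σK σ𝔤 →
        (∃ T₁ : P.archModuleCM ι T hT →ₗ[ℂ] M,
          (∀ (k : (uFormGroup (Fin 2) (Fin 1)).maximalCompact) (w : P.archModuleCM ι T hT),
              T₁ (P.archRepKCM ι T hT k w) = σK k (T₁ w)) ∧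
            (∀ (X : (uFormGroup (Fin 2) (Fin 1)).lie) (w : P.archModuleCM ι T hT),
              T₁ (P.archRepLieCM ι T hT X w) = σ𝔤 X (T₁ w)) ∧ T₁ ≠ 0) →
        ∀ δ : ℤ, (δ = 1 ∨ δ = -1) → upqTypeClasses σK σ𝔤 hM.ad_compat 1 δ ≠ ⊥ →
          ∃ ξ : OneDimAutRepH L,
            MemXiFamily P (transpose_map_cmConjRingHom_eq_of_frame L ι H T hT) (isUnit_det_of_frame L ι H T hT) μω hμu ξ) :
    cohDiscrete_memXiFamily :=
  hC2

/-! ## §3 R♭ from (C3) — no family rigidity needed -/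

/-- **R♭ BY NAME from conjunct (C3) of the sharpened engine deliverable (PLAN §19b)** — THE DELIVERABLE TEXT is this hypothesis
`hC3`: at the letters' frame there is ONE sign function `sgn : OneDimAutRepH L → ℤ` such that for EVERY discrete `P` and EVERY
one-dimensional automorphic `ξ` with `MemXiFamily P … μω hμu ξ`, every `H¹`-token of `P` at `ι` (a non-zero `(𝔤, K)`-map from
`P.archModuleCM ι T hT` to an irreducible module carrying a degree-one class of type `δ ∈ {±1}`) has `δ = sgn ξ` (in print: `sgn ξ` is
the sign of the cohomological member `πⁿ(ξ_∞) ∈ {J⁺_φ, J⁻_φ}` of `Π(ξ_∞)`, determined by `ξ_∞` alone).  Then two members `P, P′` of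
ONE ξ-family have tokens of the same type: both read `sgn ξ`.  Fold: `stub_R := memXiFamily_cohTokens_sameType_of_shape engine_C3`.
[cite: Rogawski1990, §12.3 p. 178 (Prop. 12.3.3); §14.6 Thm. 14.6.4; Prop. 15.2.1 (a)(b)] [cite: BorelWallach2000, II §5; VI Thm. 4.11] -/
theorem memXiFamily_cohTokens_sameType_of_shape
    (hC3 : ∀ (L : Type) [Field L] [NumberField L] [IsCMField L] (ι : L →+* ℂ) (H : Matrix (Fin 3) (Fin 3) L) (T : GL (Fin 3) ℂ)
      (hT : (T : Matrix (Fin 3) (Fin 3) ℂ)ᴴ * H.map ι * (T : Matrix (Fin 3) (Fin 3) ℂ) = Literature.Geometry.ComplexHyperbolic.BallModel.J),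
      (∀ τ' : L →+* ℂ, InfinitePlace.mk τ' ≠ InfinitePlace.mk ι → (H.map τ').PosDef) →
      2 ≤ Module.finrank ℚ ↥(maximalRealSubfield L) →
      ∀ (μ : Measure (adelicGroupData (↥(maximalRealSubfield L)) L (IsCMField.complexConj L) 3 H).automorphicQuotient)
        [(adelicGroupData (↥(maximalRealSubfield L)) L (IsCMField.complexConj L) 3 H).IsAutomorphicMeasure μ]
        (μω : HeckeCharacter L) (hμu : μω.IsUnitary),
        (∀ x : Literature.NumberTheory.GaloisRepresentations.ideleGroup ↥(maximalRealSubfield L),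
          μω (AdeleRing.ideleBaseChange (↥(maximalRealSubfield L)) L x) = quadraticHeckeCharCM L x) →
      ∃ sgn : OneDimAutRepH L → ℤ,
        ∀ (P : DiscreteAutomorphicRep (adelicGroupData (↥(maximalRealSubfield L)) L (IsCMField.complexConj L) 3 H) μ)
          (ξ : OneDimAutRepH L),
          MemXiFamily P (transpose_map_cmConjRingHom_eq_of_frame L ι H T hT) (isUnit_det_of_frame L ι H T hT) μω hμu ξ →
          ∀ (M : Type) [AddCommGroup M] [Module ℂ M] (σK : Representation ℂ (uFormGroup (Fin 2) (Fin 1)).maximalCompact M)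
            (σ𝔤 : (uFormGroup (Fin 2) (Fin 1)).lie →ₗ⁅ℝ⁆ Module.End ℂ M) (hM : IsGKModule (uFormGroup (Fin 2) (Fin 1)) σK σ𝔤),
            IsIrreducibleGK σK σ𝔤 →
            (∃ T₁ : P.archModuleCM ι T hT →ₗ[ℂ] M,
              (∀ (k : (uFormGroup (Fin 2) (Fin 1)).maximalCompact) (w : P.archModuleCM ι T hT),
                  T₁ (P.archRepKCM ι T hT k w) = σK k (T₁ w)) ∧
                (∀ (X : (uFormGroup (Fin 2) (Fin 1)).lie) (w : P.archModuleCM ι T hT),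
                  T₁ (P.archRepLieCM ι T hT X w) = σ𝔤 X (T₁ w)) ∧ T₁ ≠ 0) →
            ∀ δ : ℤ, (δ = 1 ∨ δ = -1) → upqTypeClasses σK σ𝔤 hM.ad_compat 1 δ ≠ ⊥ → δ = sgn ξ) :
    memXiFamily_cohTokens_sameType := by
  intro L _ _ _ ι H T hT hdef h2 μ _ μω hμu hμω P P' ξ hP hP' M _ _ σK σ𝔤 hM hirr hT₁ M' _ _ σK' σ𝔤' hM' hirr' hT₂ δ δ' hδ hδ' hne hne'
  obtain ⟨sgn, hsgn⟩ := hC3 L ι H T hT hdef h2 μ μω hμu hμω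
  rw [hsgn P ξ hP M σK σ𝔤 hM hirr hT₁ δ hδ hne, hsgn P' ξ hP' M' σK' σ𝔤' hM' hirr' hT₂ δ' hδ' hne']

/-! ## §4 All three letters from the ONE engine head `∀ frame, (C1) ∧ (C2) ∧ (C3)` -/

/-- **E1 ∧ S2♭ ∧ R♭ BY NAME from the engine deliverable `innerFormCohClassification` written as ONE frame-uniform statement
`∀ frame (μω hμu hμω), (C1) ∧ (C2) ∧ (C3)`** (PLAN.F0P3g3 §19b) — the shape the T-lines are to conclude; then
`stub_E1 ∕ stub_S2 ∕ stub_R := (letters_of_shape engine).1 ∕ .2.1 ∕ .2.2`.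
[cite: Rogawski1990, §14.6 Prop. 14.6.2, Thm. 14.6.4, Thm. 14.6.5; Thm. 13.3.6 (c); §12.3 p. 178; Prop. 15.2.1; §15.3 ¶1] -/
theorem letters_of_shape
    (h : ∀ (L : Type) [Field L] [NumberField L] [IsCMField L] (ι : L →+* ℂ) (H : Matrix (Fin 3) (Fin 3) L) (T : GL (Fin 3) ℂ)
      (hT : (T : Matrix (Fin 3) (Fin 3) ℂ)ᴴ * H.map ι * (T : Matrix (Fin 3) (Fin 3) ℂ) = Literature.Geometry.ComplexHyperbolic.BallModel.J),
      (∀ τ' : L →+* ℂ, InfinitePlace.mk τ' ≠ InfinitePlace.mk ι → (H.map τ').PosDef) →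
      2 ≤ Module.finrank ℚ ↥(maximalRealSubfield L) →
      ∀ (μ : Measure (adelicGroupData (↥(maximalRealSubfield L)) L (IsCMField.complexConj L) 3 H).automorphicQuotient)
        [(adelicGroupData (↥(maximalRealSubfield L)) L (IsCMField.complexConj L) 3 H).IsAutomorphicMeasure μ]
        (μω : HeckeCharacter L) (hμu : μω.IsUnitary),
        (∀ x : Literature.NumberTheory.GaloisRepresentations.ideleGroup ↥(maximalRealSubfield L),
          μω (AdeleRing.ideleBaseChange (↥(maximalRealSubfield L)) L x) = quadraticHeckeCharCM L x) →
      (∀ (P : DiscreteAutomorphicRep (adelicGroupData (↥(maximalRealSubfield L)) L (IsCMField.complexConj L) 3 H) μ),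
        ((adelicGroupData (↥(maximalRealSubfield L)) L (IsCMField.complexConj L) 3 H).rightRegular μ).multiplicity
            P.space.toContRep ≤ 1) ∧
      (∀ (P : DiscreteAutomorphicRep (adelicGroupData (↥(maximalRealSubfield L)) L (IsCMField.complexConj L) 3 H) μ)
        (M : Type) [AddCommGroup M] [Module ℂ M] (σK : Representation ℂ (uFormGroup (Fin 2) (Fin 1)).maximalCompact M)
        (σ𝔤 : (uFormGroup (Fin 2) (Fin 1)).lie →ₗ⁅ℝ⁆ Module.End ℂ M) (hM : IsGKModule (uFormGroup (Fin 2) (Fin 1)) σK σ𝔤),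
        IsIrreducibleGK σK σ𝔤 →
        (∃ T₁ : P.archModuleCM ι T hT →ₗ[ℂ] M,
          (∀ (k : (uFormGroup (Fin 2) (Fin 1)).maximalCompact) (w : P.archModuleCM ι T hT),
              T₁ (P.archRepKCM ι T hT k w) = σK k (T₁ w)) ∧
            (∀ (X : (uFormGroup (Fin 2) (Fin 1)).lie) (w : P.archModuleCM ι T hT),
              T₁ (P.archRepLieCM ι T hT X w) = σ𝔤 X (T₁ w)) ∧ T₁ ≠ 0) →
        ∀ δ : ℤ, (δ = 1 ∨ δ = -1) → upqTypeClasses σK σ𝔤 hM.ad_compat 1 δ ≠ ⊥ →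
          ∃ ξ : OneDimAutRepH L,
            MemXiFamily P (transpose_map_cmConjRingHom_eq_of_frame L ι H T hT) (isUnit_det_of_frame L ι H T hT) μω hμu ξ) ∧
      (∃ sgn : OneDimAutRepH L → ℤ,
        ∀ (P : DiscreteAutomorphicRep (adelicGroupData (↥(maximalRealSubfield L)) L (IsCMField.complexConj L) 3 H) μ)
          (ξ : OneDimAutRepH L),
          MemXiFamily P (transpose_map_cmConjRingHom_eq_of_frame L ι H T hT) (isUnit_det_of_frame L ι H T hT) μω hμu ξ →
          ∀ (M : Type) [AddCommGroup M] [Module ℂ M] (σK : Representation ℂ (uFormGroup (Fin 2) (Fin 1)).maximalCompact M)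
            (σ𝔤 : (uFormGroup (Fin 2) (Fin 1)).lie →ₗ⁅ℝ⁆ Module.End ℂ M) (hM : IsGKModule (uFormGroup (Fin 2) (Fin 1)) σK σ𝔤),
            IsIrreducibleGK σK σ𝔤 →
            (∃ T₁ : P.archModuleCM ι T hT →ₗ[ℂ] M,
              (∀ (k : (uFormGroup (Fin 2) (Fin 1)).maximalCompact) (w : P.archModuleCM ι T hT),
                  T₁ (P.archRepKCM ι T hT k w) = σK k (T₁ w)) ∧
                (∀ (X : (uFormGroup (Fin 2) (Fin 1)).lie) (w : P.archModuleCM ι T hT),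
                  T₁ (P.archRepLieCM ι T hT X w) = σ𝔤 X (T₁ w)) ∧ T₁ ≠ 0) →
            ∀ δ : ℤ, (δ = 1 ∨ δ = -1) → upqTypeClasses σK σ𝔤 hM.ad_compat 1 δ ≠ ⊥ → δ = sgn ξ)) :
    innerFormMultiplicityLeOne ∧ cohDiscrete_memXiFamily ∧ memXiFamily_cohTokens_sameType :=
  ⟨innerFormMultiplicityLeOne_of_shape fun L _ _ _ ι H T hT hdef h2 μ _ μω hμu hμω => (h L ι H T hT hdef h2 μ μω hμu hμω).1,
    cohDiscrete_memXiFamily_of_shape fun L _ _ _ ι H T hT hdef h2 μ _ μω hμu hμω => (h L ι H T hT hdef h2 μ μω hμu hμω).2.1,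
    memXiFamily_cohTokens_sameType_of_shape fun L _ _ _ ι H T hT hdef h2 μ _ μω hμu hμω => (h L ι H T hT hdef h2 μ μω hμu hμω).2.2⟩

/-! ## §5 (C3) ⟺ R♭: the sharpened conjunct carries exactly R♭'s content -/

/-- **R♭ ⇒ (C3)**: given R♭, the sign function `sgn ξ := 1` if SOME member of the ξ-family carries an `H¹`-token of type `1`, else
`−1`, satisfies (C3) (a type-`1` token gives `sgn ξ = 1`; a type-`−1` token forces `sgn ξ = −1`, for a type-`1` token elsewhere in
the family would contradict R♭).  So (C3) asks NO family rigidity and NO strength beyond R♭ of the engine.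
[cite: Rogawski1990, §12.3 p. 178 (Prop. 12.3.3); §14.6 Thm. 14.6.4] -/
theorem shape_C3_of_memXiFamily_cohTokens_sameType (hR : memXiFamily_cohTokens_sameType)
    (L : Type) [Field L] [NumberField L] [IsCMField L] (ι : L →+* ℂ) (H : Matrix (Fin 3) (Fin 3) L) (T : GL (Fin 3) ℂ)
    (hT : (T : Matrix (Fin 3) (Fin 3) ℂ)ᴴ * H.map ι * (T : Matrix (Fin 3) (Fin 3) ℂ) = Literature.Geometry.ComplexHyperbolic.BallModel.J)
    (hdef : ∀ τ' : L →+* ℂ, InfinitePlace.mk τ' ≠ InfinitePlace.mk ι → (H.map τ').PosDef)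
    (h2 : 2 ≤ Module.finrank ℚ ↥(maximalRealSubfield L))
    (μ : Measure (adelicGroupData (↥(maximalRealSubfield L)) L (IsCMField.complexConj L) 3 H).automorphicQuotient)
    [(adelicGroupData (↥(maximalRealSubfield L)) L (IsCMField.complexConj L) 3 H).IsAutomorphicMeasure μ]
    (μω : HeckeCharacter L) (hμu : μω.IsUnitary)
    (hμω : ∀ x : Literature.NumberTheory.GaloisRepresentations.ideleGroup ↥(maximalRealSubfield L),
      μω (AdeleRing.ideleBaseChange (↥(maximalRealSubfield L)) L x) = quadraticHeckeCharCM L x) :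
    ∃ sgn : OneDimAutRepH L → ℤ,
      ∀ (P : DiscreteAutomorphicRep (adelicGroupData (↥(maximalRealSubfield L)) L (IsCMField.complexConj L) 3 H) μ)
        (ξ : OneDimAutRepH L),
        MemXiFamily P (transpose_map_cmConjRingHom_eq_of_frame L ι H T hT) (isUnit_det_of_frame L ι H T hT) μω hμu ξ →
        ∀ (M : Type) [AddCommGroup M] [Module ℂ M] (σK : Representation ℂ (uFormGroup (Fin 2) (Fin 1)).maximalCompact M)
          (σ𝔤 : (uFormGroup (Fin 2) (Fin 1)).lie →ₗ⁅ℝ⁆ Module.End ℂ M) (hM : IsGKModule (uFormGroup (Fin 2) (Fin 1)) σK σ𝔤),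
          IsIrreducibleGK σK σ𝔤 →
          (∃ T₁ : P.archModuleCM ι T hT →ₗ[ℂ] M,
            (∀ (k : (uFormGroup (Fin 2) (Fin 1)).maximalCompact) (w : P.archModuleCM ι T hT),
                T₁ (P.archRepKCM ι T hT k w) = σK k (T₁ w)) ∧
              (∀ (X : (uFormGroup (Fin 2) (Fin 1)).lie) (w : P.archModuleCM ι T hT),
                T₁ (P.archRepLieCM ι T hT X w) = σ𝔤 X (T₁ w)) ∧ T₁ ≠ 0) →
          ∀ δ : ℤ, (δ = 1 ∨ δ = -1) → upqTypeClasses σK σ𝔤 hM.ad_compat 1 δ ≠ ⊥ → δ = sgn ξ := by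
  classical
  -- `Pos ξ`: some member of the ξ-family carries an `H¹`-token of type `1`.
  let Pos : OneDimAutRepH L → Prop := fun ξ =>
    ∃ (P₀ : DiscreteAutomorphicRep (adelicGroupData (↥(maximalRealSubfield L)) L (IsCMField.complexConj L) 3 H) μ)
      (M₀ : Type) (_ : AddCommGroup M₀) (_ : Module ℂ M₀) (σK₀ : Representation ℂ (uFormGroup (Fin 2) (Fin 1)).maximalCompact M₀)
      (σ𝔤₀ : (uFormGroup (Fin 2) (Fin 1)).lie →ₗ⁅ℝ⁆ Module.End ℂ M₀) (hM₀ : IsGKModule (uFormGroup (Fin 2) (Fin 1)) σK₀ σ𝔤₀),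
      MemXiFamily P₀ (transpose_map_cmConjRingHom_eq_of_frame L ι H T hT) (isUnit_det_of_frame L ι H T hT) μω hμu ξ ∧
      IsIrreducibleGK σK₀ σ𝔤₀ ∧
      (∃ T₁ : P₀.archModuleCM ι T hT →ₗ[ℂ] M₀,
        (∀ (k : (uFormGroup (Fin 2) (Fin 1)).maximalCompact) (w : P₀.archModuleCM ι T hT),
            T₁ (P₀.archRepKCM ι T hT k w) = σK₀ k (T₁ w)) ∧
          (∀ (X : (uFormGroup (Fin 2) (Fin 1)).lie) (w : P₀.archModuleCM ι T hT),
            T₁ (P₀.archRepLieCM ι T hT X w) = σ𝔤₀ X (T₁ w)) ∧ T₁ ≠ 0) ∧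
      upqTypeClasses σK₀ σ𝔤₀ hM₀.ad_compat 1 1 ≠ ⊥
  refine ⟨fun ξ => if Pos ξ then 1 else -1, ?_⟩
  intro P ξ hP M _ _ σK σ𝔤 hM hirr hT₁ δ hδ hne
  rcases hδ with rfl | rfl
  · -- a type-`1` token: `Pos ξ` holds
    have hpos : Pos ξ := ⟨P, M, inferInstance, inferInstance, σK, σ𝔤, hM, hP, hirr, hT₁, hne⟩
    simp only [if_pos hpos]
  · -- a type-`-1` token: no type-`1` token anywhere in the family, by R♭
    have hneg : ¬ Pos ξ := by
      rintro ⟨P₀, M₀, _, _, σK₀, σ𝔤₀, hM₀, hP₀, hirr₀, hT₀, hne₀⟩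
      have h := hR L ι H T hT hdef h2 μ μω hμu hμω P₀ P ξ hP₀ hP M₀ σK₀ σ𝔤₀ hM₀ hirr₀ hT₀ M σK σ𝔤 hM hirr hT₁ 1 (-1)
        (Or.inl rfl) (Or.inr rfl) hne₀ hne
      omega
    simp only [if_neg hneg]

/-- **(C3) ⟺ R♭** (frame-uniform): the sharpened engine conjunct (C3) of PLAN §19b is EQUIVALENT to the letter R♭ ★
`Rogawski1990.memXiFamily_cohTokens_sameType` as typed — `⇒` is §3, `⇐` is `shape_C3_of_memXiFamily_cohTokens_sameType`.
[cite: Rogawski1990, §12.3 p. 178 (Prop. 12.3.3); §14.6 Thm. 14.6.4] -/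
theorem shape_C3_iff :
    (∀ (L : Type) [Field L] [NumberField L] [IsCMField L] (ι : L →+* ℂ) (H : Matrix (Fin 3) (Fin 3) L) (T : GL (Fin 3) ℂ)
      (hT : (T : Matrix (Fin 3) (Fin 3) ℂ)ᴴ * H.map ι * (T : Matrix (Fin 3) (Fin 3) ℂ) = Literature.Geometry.ComplexHyperbolic.BallModel.J),
      (∀ τ' : L →+* ℂ, InfinitePlace.mk τ' ≠ InfinitePlace.mk ι → (H.map τ').PosDef) →
      2 ≤ Module.finrank ℚ ↥(maximalRealSubfield L) →
      ∀ (μ : Measure (adelicGroupData (↥(maximalRealSubfield L)) L (IsCMField.complexConj L) 3 H).automorphicQuotient)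
        [(adelicGroupData (↥(maximalRealSubfield L)) L (IsCMField.complexConj L) 3 H).IsAutomorphicMeasure μ]
        (μω : HeckeCharacter L) (hμu : μω.IsUnitary),
        (∀ x : Literature.NumberTheory.GaloisRepresentations.ideleGroup ↥(maximalRealSubfield L),
          μω (AdeleRing.ideleBaseChange (↥(maximalRealSubfield L)) L x) = quadraticHeckeCharCM L x) →
      ∃ sgn : OneDimAutRepH L → ℤ,
        ∀ (P : DiscreteAutomorphicRep (adelicGroupData (↥(maximalRealSubfield L)) L (IsCMField.complexConj L) 3 H) μ)
          (ξ : OneDimAutRepH L),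
          MemXiFamily P (transpose_map_cmConjRingHom_eq_of_frame L ι H T hT) (isUnit_det_of_frame L ι H T hT) μω hμu ξ →
          ∀ (M : Type) [AddCommGroup M] [Module ℂ M] (σK : Representation ℂ (uFormGroup (Fin 2) (Fin 1)).maximalCompact M)
            (σ𝔤 : (uFormGroup (Fin 2) (Fin 1)).lie →ₗ⁅ℝ⁆ Module.End ℂ M) (hM : IsGKModule (uFormGroup (Fin 2) (Fin 1)) σK σ𝔤),
            IsIrreducibleGK σK σ𝔤 →
            (∃ T₁ : P.archModuleCM ι T hT →ₗ[ℂ] M,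
              (∀ (k : (uFormGroup (Fin 2) (Fin 1)).maximalCompact) (w : P.archModuleCM ι T hT),
                  T₁ (P.archRepKCM ι T hT k w) = σK k (T₁ w)) ∧
                (∀ (X : (uFormGroup (Fin 2) (Fin 1)).lie) (w : P.archModuleCM ι T hT),
                  T₁ (P.archRepLieCM ι T hT X w) = σ𝔤 X (T₁ w)) ∧ T₁ ≠ 0) →
            ∀ δ : ℤ, (δ = 1 ∨ δ = -1) → upqTypeClasses σK σ𝔤 hM.ad_compat 1 δ ≠ ⊥ → δ = sgn ξ) ↔
    memXiFamily_cohTokens_sameType :=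
  ⟨memXiFamily_cohTokens_sameType_of_shape,
    fun hR L _ _ _ ι H T hT hdef h2 μ _ μω hμu hμω =>
      shape_C3_of_memXiFamily_cohTokens_sameType hR L ι H T hT hdef h2 μ μω hμu hμω⟩

end Summit.HodgeConjecture.HodgeConjecture.Cruxes.H413.F0P3LettersOfClassificationShape

end
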